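import Mathlib
import Summits.Ventures.FusionMHD.Models.CerfonFreidbergIterLikeQHalfResData
import Summits.Ventures.FusionMHD.Models.CerfonFreidbergIterLikeQHalfVolume
import Summits.Ventures.FusionMHD.Models.CerfonFreidbergIterLikeQHalfResistive
import HarnessLib

/-!
# Ventures/FusionMHD — Models/CerfonFreidbergIterLikeQHalfVolumeRegisters.lean: ★ CERTIFIED `V′` AND `V″` OF THE IMPLICIT SURFACE `ψ_N = 1/2` OF THE
# Cerfon–Freidberg ITER-like MODEL FLUX — Jardin's (5.29) `V′ = dV/dψ ∈ [89.0946, 89.0947]` and `V″ = d²V/dψ² ∈ [346.848, 346.851]` (in the flux label `u`)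

HONEST FRAMING (LADDER-GRIDFUSION three columns; CF rung; rider of «F2.R2-CF-MERCIER-IMPLICIT» — two of the thirteen (8.134) inputs BY NAME as certified numbers,
memo §2 «certified profile functionals on a shaped non-polynomial equilibrium»).
* CERTIFIED (kernel, this file + imports; axioms standard): with model-7 g5/g6's theorems `volumeDerivE_half_eq_polar` (Jardin (5.29) `V′ = dV/du` of the glued loop
  IS `2π∫₀^{2π} volKernel`, and `hasDerivAt_torVolume_half`: it IS the derivative of the enclosed volume `torVolume`) and `hasDerivAt_volumeDerivE_half`
  (`V″ = 2π∫₀^{2π} volKernelDs/D`), the mirror halving `registers_two_mul`, and model-7 g7's certified `[0, π]` registers `W` (`resV_half_bounds`) and `Wd`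
  (`mercW_half_bounds`): **`volumeDerivE_half_bounds`** — `89.0946 ≤ V′(u₀) ≤ 89.0947` (`V′ = 4π·W`); **`deriv_volumeDerivE_half_bounds`** —
  `346.848 ≤ dV′/du(u₀) ≤ 346.851` (`V″ = 4π·Wd`).
* VALIDATED (never used): lineage-1 floats `V′ = 89.0946570`, `V″ = 346.850` (MODEL-7-NOTES §6), inside.
* MODELLED: analytic Cerfon–Freidberg family; functionals of a MODEL surface in the MODEL's flux label — nothing about a device or stability.
Typer/prover: gridfusion-model-7 (g7), 2026-08-28.  Citations: Jardin 2010 §5.3 (5.29), §8.5.4 (8.134) [Jardin2010]; Freidberg 2014 (6.22) [Freidberg2014].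
-/

noncomputable section

open Set MeasureTheory intervalIntegral
open Literature.MathematicalPhysics.MHD Literature.MathematicalPhysics.MHD.CerfonFreidberg Literature.MathematicalPhysics.MHD.GradShafranov
open Summit.Ventures.FusionMHD.Models.PolarRay

set_option autoImplicit false

namespace Summit.Ventures.FusionMHD.Models.CFIterLike.QHalf

/-- **★ `V′(ψ_N = 1/2) = volumeDerivE U (loop X_a 0 ρ) (2π) ∈ [89.0946, 89.0947]`** (`= 4π·W`, `W = ∫₀^π R s/D` certified). [cite: Jardin2010, §5.3 eq. (5.29)] -/
theorem volumeDerivE_half_bounds :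
    (890946 / 10000 : ℝ) ≤ volumeDerivE U (loop Xa 0 ρ) (2 * Real.pi) ∧ volumeDerivE U (loop Xa 0 ρ) (2 * Real.pi) ≤ (890947 / 10000 : ℝ) := by
  obtain ⟨h1, h2, -⟩ := resV_half_bounds
  obtain ⟨-, -, -, -, -, -, e7, -⟩ := registers_two_mul (u := u₀) (F := 1)
  norm_num [resVLo, resVHi] at h1 h2
  have hpi1 := Real.pi_gt_d20; have hpi2 := Real.pi_lt_d20
  rw [volumeDerivE_half_eq_polar]
  change (890946 / 10000 : ℝ) ≤ 2 * Real.pi * ∫ θ in (0 : ℝ)..(2 * Real.pi), volKernel Xa Dfield θ (rayRadius U Xa 0 u₀ θ)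
    ∧ 2 * Real.pi * ∫ θ in (0 : ℝ)..(2 * Real.pi), volKernel Xa Dfield θ (rayRadius U Xa 0 u₀ θ) ≤ (890947 / 10000 : ℝ)
  rw [e7]
  change (890946 / 10000 : ℝ) ≤ 2 * Real.pi * (2 * ∫ θ in (0 : ℝ)..Real.pi, KV θ (ρ θ))
    ∧ 2 * Real.pi * (2 * ∫ θ in (0 : ℝ)..Real.pi, KV θ (ρ θ)) ≤ (890947 / 10000 : ℝ)
  constructor <;> nlinarith

/-- **★ `V″(ψ_N = 1/2) = d/du volumeDerivE ∈ [346.848, 346.851]`** (`= 4π·Wd`, `Wd = ∫₀^π volKernelDs/D` certified; the derivative EXISTS by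
`hasDerivAt_volumeDerivE_half`). [cite: Jardin2010, §8.5.4 eq. (8.134)] -/
theorem deriv_volumeDerivE_half_bounds :
    (346848 / 1000 : ℝ) ≤ deriv (fun u => volumeDerivE U (loop Xa 0 (rayRadius U Xa 0 u)) (2 * Real.pi)) u₀
    ∧ deriv (fun u => volumeDerivE U (loop Xa 0 (rayRadius U Xa 0 u)) (2 * Real.pi)) u₀ ≤ (346851 / 1000 : ℝ) := by
  rw [hasDerivAt_volumeDerivE_half.deriv]
  obtain ⟨h1, h2, -⟩ := mercW_half_bounds
  obtain ⟨-, e2, -⟩ := registers_two_mul (u := u₀) (F := 1)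
  norm_num [mercWLo, mercWHi] at h1 h2
  have hpi1 := Real.pi_gt_d20; have hpi2 := Real.pi_lt_d20
  change (346848 / 1000 : ℝ) ≤ 2 * Real.pi * ∫ θ in (0 : ℝ)..(2 * Real.pi), volKernelDs Xa Dfield F2field θ (rayRadius U Xa 0 u₀ θ) / Dfield θ (rayRadius U Xa 0 u₀ θ)
    ∧ 2 * Real.pi * ∫ θ in (0 : ℝ)..(2 * Real.pi), volKernelDs Xa Dfield F2field θ (rayRadius U Xa 0 u₀ θ) / Dfield θ (rayRadius U Xa 0 u₀ θ) ≤ (346851 / 1000 : ℝ)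
  rw [e2]
  change (346848 / 1000 : ℝ) ≤ 2 * Real.pi * (2 * ∫ θ in (0 : ℝ)..Real.pi, KW θ (ρ θ))
    ∧ 2 * Real.pi * (2 * ∫ θ in (0 : ℝ)..Real.pi, KW θ (ρ θ)) ≤ (346851 / 1000 : ℝ)
  constructor <;> nlinarith

end Summit.Ventures.FusionMHD.Models.CFIterLike.QHalf

end
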